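import Summits.QuantumFields.BalabanUV.Beta.GAN24.BornLambdaLineage
import Summits.QuantumFields.BalabanUV.Beta.GAN24.StencilSlotVHRoot

/-!
# `BalabanUV.Beta.GAN24.BornBorderLineage` — binder row G-an2-4 / (CONV-C), CT-ROUTE, the row owner's `gen19/BORNSEC-PLAN-v0.md` (V8) «assembly CT-3cV»
# [leaf-01 or owner], PART 1b (the V-born = BORDER sector, INSTANCE side): **THE V-SOURCE IN UNITS IS THE SAME TABLE `cVH • vhSAt ρ` AT EVERY LEVEL; ITS ONE-STEP
# IMAGE IS THE TWO MIXED CHANNELS OF leaf-01 g43's FOUR-CHANNEL READ; AND THE V-BORN REMAINDER IN UNITS IS THE FRESH SOURCE PLUS THE ONE-STEP IMAGES OF THE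
# EARLIER SOURCES TRANSPORTED AS THREE-LEG PUSHES FROM THE NEXT LEVEL** (leaf-03-g52's precision (P1) l.32842 made into theorems)

NOT IN PRINT; OUR BOOKKEEPING (G-an2-4 formalisation swarm → CRUX TEAM (2), leaf prover `b2b-balaban-gan24-formalise-leaf-01`, staged gen 59 under «MINE» on
(V8), journal `CLAIMS.log` l.32877; filed gen 60 on the row owner gan24-p1-g20's «GO, file at will» (W10) l.33389; names PROVISIONAL — the owner may rename / re-cut).  [folklore] bookkeeping over tree theorems BY NAME: leaf-03's (E-α-V) `SrecBornSector`,
the row owner's `StencilSlotVHRoot.unitS_vhPiece_eq` ∕ an1's `locStencil_vhSAt`, leaf-01 g43's `RespStepBm.e3K_coDressKBmAt_KStepUnit` (the four-channel read), the sister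
module `BornLambdaLineage` (sector split, re-indexed closed form).  0 `def`, 0 cited facts, 0 `def … : Prop`, 0 sorry.  HONEST FRAMING (cell contract, verbatim):
«discharging `BetaPertH` makes Bałaban's UV stability UNCONDITIONAL — a real constructive-QFT result; it is NOT the continuum limit and NOT the Clay problem.»  HONEST
DEPENDENCY (verbatim): «continuum YM on T⁴ ⇐ BetaPertH ∧ nine spine estimates (0/9 proved); BetaPertH ⇐ (D1) ∧ (D4) ∧ CAP+tail; G-an2-4 gates asym, D1 and NE2/3/4.»

## What (generic `d`; in-block root `ρ = toSite rr`, `rr ∈ box (d+1) Lc`, where stated)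
* §1 THE V-SOURCE IN UNITS: `freshAt_v_zero ∕ _succ`, **`unitS_freshAt_v`** (`unitS_j (freshAt Lc ρ cVH 0 j) = cVH • vhSAt ρ` for EVERY `j` — the owner's `unitS_vhPiece_eq`
  ∕ asym1's `unitS_one`), **`exists_hX_v`** (UNCONDITIONAL `j`-uniform locality, any rate: an1's `locStencil_vhSAt`), class membership.
* §2 THE ONE-STEP IMAGE: **`unitStepMap_v_eq_two_push₃`** — `unitStepMap Lc ρ cE i (cVH • vhSAt ρ) = (cE·Lc^{2(d+1)}) • (−(push₃ (−R_i) (colM K̃_i Lc) R_i (reslot inl inr (cVH • V))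
  + push₃ (rowMM K̃_i Lc) R_i R_i (reslot inr inl (cVH • V))))`, `R_i = respStepBm ρ Lc (Lc^i) (Lc^(i+1))`, `K̃_i = KStepUnit Lc i` — leaf-01 g43's four-channel read with the
  two diagonal channels killed (`vhSAt` vanishes on the ff and mm blocks); it is ff-valued and in the class.
* §3 **`unitS_bornV_eq_sum`** ∕ **`unitS_bornV_eq_sum_push₃`**: `unitS_k (bornSecAt Lc ρ cE cVH 0 k) = cVH • vhSAt ρ + Σ_{i<k} transport unitStepMap (i+1) (k−1−i) X_i`,
  `X_i :=` the one-step image of §2, and every transport with `≥ 1` step is `(cE·Lc^{2(d+1)})^{k−1−i} • push₃ T′_i T′_i T′_i X_i`, `T′_i = legChain (respStepBmSeq ρ Lc) (i+1) (k−2−i)`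
  (leaf-03's `transport_unitStepMap_succ_eq_push₃` at base `i+1`).
NO undressed∕contact split is typed here: for the V sector the comparison object is a DESIGN choice (the multiplier leg `T′ ∘ colM K̃_i` carries the dressed chain `T′`; see
`HOME/b2b-balaban-gan24-formalise-leaf-01/g59/BORNSEC-EXPONENT-LEDGER.md` §3–§4).  Discharges NO slot letter; asserts NO shape of Bałaban's stencils; NO estimate;
0 wall binders; NEVER «G-an2-4 closed»; NOT D1, NOT BetaPertH, NOT continuum, NOT Clay.
-/

noncomputable section

open Finset
open scoped BigOperators
open Literature.MathematicalPhysics.QuantumFieldTheory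
open Literature.MathematicalPhysics.QuantumFieldTheory.Balaban1983to89
open Literature.MathematicalPhysics.QuantumFieldTheory.Balaban1983to89.Beta
open ExpKernelCalculus (MKer Decays)
open AffineAveraging (box toSite)
open OneStepResolventKernel (Fib LocStencil)
open OneStepKernelFamily (KInvStep decays_KInvStep)
open BalabanStepJetsSucc (wVH)
open StepJetData (locStencil_add locStencil_smul)
open BalabanStepJets (locStencil_mono)
open AveragingHessianKernels (ell)
open AveragingHessianKernelsRooted (vhSAt locStencil_vhSAt)
open Summit.QuantumFields.BalabanUV.Beta.HessKerDressedUnits (unitS unitS_one locStencil_unitS decays_unitK)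
open Summit.QuantumFields.BalabanUV.Beta.AxialDressingRooted (one_le_of_neZero)
open Summit.QuantumFields.BalabanUV.Beta.GAN24.CombesThomas (sfStep smStep KStepUnit)
open Summit.QuantumFields.BalabanUV.Beta.GAN24.StencilSlotOfShapes (locStencil_mono')
open Summit.QuantumFields.BalabanUV.Beta.GAN24.Push4 (IsFF)
open Summit.QuantumFields.BalabanUV.Beta.GAN24.Push4Iter (legChain)
open Summit.QuantumFields.BalabanUV.Beta.GAN24.Push3 (push₃ isFF_push₃)
open Summit.QuantumFields.BalabanUV.Beta.GAN24.AffineUnroll (transport transport_zero transport_succ')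
open Summit.QuantumFields.BalabanUV.Beta.GAN24.RespStepBmDecompExact (respStepBmSeq)
open Summit.QuantumFields.BalabanUV.Beta.GAN24.RespStepBm (respStepBm e3K_coDressKBmAt_KStepUnit)
open Summit.QuantumFields.BalabanUV.Beta.GAN24.SrecLinearPartEq (colM rowMM reslot push₃_zero)
open Summit.QuantumFields.BalabanUV.Beta.GAN24.SrecUnits (KStepUnit_eq)
open Summit.QuantumFields.BalabanUV.Beta.GAN24.SrecWilsonSector (bornSecAt isFF_smul)
open Summit.QuantumFields.BalabanUV.Beta.GAN24.SrecBornSector (freshAt stepMap unitStepMap isLoc_stepMap isLoc_freshAt unitS_stepMap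
  transport_unitStepMap_succ_eq_push₃)
open Summit.QuantumFields.BalabanUV.Beta.GAN24.StencilSlotVHRoot (vhSAt_inl_inl vhSAt_inr_inr unitS_vhPiece_eq)
open Summit.QuantumFields.BalabanUV.Beta.GAN24.ThirdJetKernel (e3K)
open Summit.QuantumFields.BalabanUV.Beta.GAN24.BornLambdaLineage (unitS_bornSecAt_eq_sum_range)

namespace Summit.QuantumFields.BalabanUV.Beta.GAN24.BornBorderLineage

variable {d : ℕ} {Lc : ℕ} [NeZero Lc]

/-! ## §1 The V-source in units is the same table at every level -/

/-- [folklore] The V-source of member `0`: `freshAt Lc ρ cVH 0 0 = cVH • vhSAt ρ`. -/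
theorem freshAt_v_zero (ρ : Fin (d + 1) → ℤ) (cVH : ℝ) :
    freshAt Lc ρ cVH 0 0 = fun κ u => cVH • vhSAt ρ d Lc rfl κ u := by
  funext κ u
  simp only [freshAt, zero_smul, add_zero]

/-- [folklore] The V-source of member `j+1`: `freshAt Lc ρ cVH 0 (j+1) = (cVH·wVH (j+1)) • vhSAt ρ`. -/
theorem freshAt_v_succ (ρ : Fin (d + 1) → ℤ) (cVH : ℝ) (j : ℕ) :
    freshAt Lc ρ cVH 0 (j + 1) = fun κ u => (cVH * wVH d Lc (j + 1)) • vhSAt ρ d Lc rfl κ u := by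
  funext κ u
  simp only [freshAt, zero_mul, zero_smul, add_zero]

/-- NOT IN PRINT; OUR BOOKKEEPING.  **THE V-SOURCE IN ITS OWN UNITS IS `cVH • vhSAt ρ` AT EVERY LEVEL** (member `0`: asym1's `unitS_one`; member `j+1`: the row owner's
`StencilSlotVHRoot.unitS_vhPiece_eq` — the provisional numeral `wVH = (Lc^j)^{2(d+2)}` against the adopted units cancels exactly). -/
theorem unitS_freshAt_v (ρ : Fin (d + 1) → ℤ) (cVH : ℝ) :
    ∀ j : ℕ, unitS (sfStep Lc j) (smStep d Lc j) (freshAt Lc ρ cVH 0 j) = fun κ u => cVH • vhSAt ρ d Lc rfl κ u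
  | 0 => by rw [freshAt_v_zero, show sfStep Lc 0 = 1 by simp [sfStep], show smStep d Lc 0 = 1 by simp [smStep], unitS_one]
  | j + 1 => by rw [freshAt_v_succ]; exact unitS_vhPiece_eq ρ cVH (j + 1)

/-- NOT IN PRINT; OUR BOOKKEEPING ((V7)'s V-twin in `LocStencil` form, UNCONDITIONAL, generic `d`, any rate `δ ≥ 0`).  **THE BORN V-TABLES ARE LOCAL STENCIL FAMILIES IN
THEIR OWN UNITS WITH ONE CONSTANT FOR ALL LEVELS AND ALL IN-BLOCK ROOTS** (an1's `locStencil_vhSAt`: the border table is finitely supported). -/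
theorem exists_hX_v (hLc : 1 ≤ Lc) (cVH : ℝ) {δ : ℝ} (hδ : 0 ≤ δ) :
    ∀ (rr : Fin (d + 1) → ℕ), rr ∈ box (d + 1) Lc → ∀ k : ℕ,
      LocStencil (unitS (sfStep Lc k) (smStep d Lc k) (freshAt Lc (toSite rr) cVH 0 k))
        (|cVH| * (3 * (ell (d + 1) Lc : ℝ) ^ 2 * Real.exp (4 * ((d : ℝ) + 1) * Lc * δ))) δ := by
  intro rr hrr k
  rw [unitS_freshAt_v]
  exact locStencil_smul cVH (locStencil_vhSAt hLc hrr hδ)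

/-! ## §2 The one-step image of the V-source: the two mixed channels of the four-channel read -/

omit [NeZero Lc] in
/-- [folklore] The border table has no field–field channel. -/
theorem reslot_inl_inl_v (ρ : Fin (d + 1) → ℤ) (cVH : ℝ) :
    reslot Sum.inl Sum.inl (fun κ u => cVH • vhSAt ρ d Lc rfl κ u) = fun _ _ => 0 := by
  funext κ u x z a b
  rcases a with κ₁ | μ <;> rcases b with κ₂ | ν <;> simp [reslot, vhSAt_inl_inl]

omit [NeZero Lc] in
/-- [folklore] The border table has no multiplier–multiplier channel. -/
theorem reslot_inr_inr_v (ρ : Fin (d + 1) → ℤ) (cVH : ℝ) :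
    reslot Sum.inr Sum.inr (fun κ u => cVH • vhSAt ρ d Lc rfl κ u) = fun _ _ => 0 := by
  funext κ u x z a b
  rcases a with κ₁ | μ <;> rcases b with κ₂ | ν <;> simp [reslot, vhSAt_inr_inr]

/-- NOT IN PRINT; OUR BOOKKEEPING.  **THE ONE-STEP IMAGE OF THE V-SOURCE IS THE TWO MIXED CHANNELS OF leaf-01 g43's FOUR-CHANNEL READ** (in-block root): with
`R_i = respStepBm ρ Lc (Lc^i) (Lc^(i+1))` (ONE dressed step) and `K̃_i = KStepUnit Lc i` (multiplier legs UNDRESSED),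
`unitStepMap Lc ρ cE i (cVH • vhSAt ρ) = (cE·Lc^{2(d+1)}) • (−(push₃ (−R_i) (colM K̃_i Lc) R_i (reslot inl inr (cVH • vhSAt ρ)) + push₃ (rowMM K̃_i Lc) R_i R_i (reslot inr inl (cVH • vhSAt ρ))))`
— the field–field and multiplier–multiplier channels vanish because the border table does. -/
theorem unitStepMap_v_eq_two_push₃ {rr : Fin (d + 1) → ℕ} (hrr : rr ∈ box (d + 1) Lc) (cE cVH : ℝ) (i : ℕ) :
    unitStepMap Lc (toSite rr) cE i (fun κ u => cVH • vhSAt (toSite rr) d Lc rfl κ u) = fun κ' u' =>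
      (cE * (Lc : ℝ) ^ (2 * (d + 1))) •
        -(push₃ (-respStepBm (toSite rr) Lc (Lc ^ i) (Lc ^ (i + 1))) (colM (KStepUnit (d := d) Lc i) Lc)
              (respStepBm (toSite rr) Lc (Lc ^ i) (Lc ^ (i + 1))) (reslot Sum.inl Sum.inr fun κ u => cVH • vhSAt (toSite rr) d Lc rfl κ u) κ' u'
          + push₃ (rowMM (KStepUnit (d := d) Lc i) Lc) (respStepBm (toSite rr) Lc (Lc ^ i) (Lc ^ (i + 1)))
              (respStepBm (toSite rr) Lc (Lc ^ i) (Lc ^ (i + 1))) (reslot Sum.inr Sum.inl fun κ u => cVH • vhSAt (toSite rr) d Lc rfl κ u) κ' u') := by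
  have hLc : 1 ≤ Lc := one_le_of_neZero Lc
  -- the unit step resolvent decays per level (an2's `decays_KInvStep` through asym1's `decays_unitK`; = sister `BornLambdaContactCells.exists_decays_KStepUnit`)
  obtain ⟨m, CK, hm, -, hK0⟩ := decays_KInvStep (d := d) (Lc := Lc) i
  obtain ⟨C, hK⟩ : ∃ C, Decays (KStepUnit (d := d) Lc i) C m := ⟨_, by rw [KStepUnit_eq]; exact decays_unitK hK0⟩
  have hS : LocStencil (fun κ u => cVH • vhSAt (toSite rr) d Lc rfl κ u)
      (|cVH| * (3 * (ell (d + 1) Lc : ℝ) ^ 2 * Real.exp (4 * ((d : ℝ) + 1) * Lc * 1))) 1 :=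
    locStencil_smul cVH (locStencil_vhSAt hLc hrr zero_le_one)
  funext κ' u'
  show (cE * (Lc : ℝ) ^ (2 * (d + 1))) • e3K _ _ _ κ' u' = _
  rw [e3K_coDressKBmAt_KStepUnit hrr hK hm hS one_pos κ' u', reslot_inl_inl_v, reslot_inr_inr_v, push₃_zero, push₃_zero, zero_add, add_zero]

omit [NeZero Lc] in
/-- [folklore] Sums of ff-valued kernels are ff-valued. -/
theorem isFF_add {V V' : MKer (d + 1) (Fib d)} (hV : IsFF V) (hV' : IsFF V') : IsFF (V + V') :=
  ⟨fun x z μ b => by rw [Pi.add_apply, Pi.add_apply, Pi.add_apply, Pi.add_apply, hV.1, hV'.1, add_zero],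
    fun x z a ν => by rw [Pi.add_apply, Pi.add_apply, Pi.add_apply, Pi.add_apply, hV.2, hV'.2, add_zero]⟩

omit [NeZero Lc] in
/-- [folklore] Negatives of ff-valued kernels are ff-valued. -/
theorem isFF_neg {V : MKer (d + 1) (Fib d)} (hV : IsFF V) : IsFF (-V) :=
  ⟨fun x z μ b => by rw [Pi.neg_apply, Pi.neg_apply, Pi.neg_apply, Pi.neg_apply, hV.1, neg_zero],
    fun x z a ν => by rw [Pi.neg_apply, Pi.neg_apply, Pi.neg_apply, Pi.neg_apply, hV.2, neg_zero]⟩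

/-- [folklore] The one-step image of the V-source is ff-valued (read off §2's two channels; `Push3.isFF_push₃`). -/
theorem isFF_unitStepMap_v {rr : Fin (d + 1) → ℕ} (hrr : rr ∈ box (d + 1) Lc) (cE cVH : ℝ) (i : ℕ) (κ : Fin (d + 1)) (u : Fin (d + 1) → ℤ) :
    IsFF (unitStepMap Lc (toSite rr) cE i (fun κ u => cVH • vhSAt (toSite rr) d Lc rfl κ u) κ u) := by
  rw [unitStepMap_v_eq_two_push₃ hrr cE cVH i]
  have h1 := isFF_push₃ (-respStepBm (toSite rr) Lc (Lc ^ i) (Lc ^ (i + 1))) (colM (KStepUnit (d := d) Lc i) Lc)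
    (respStepBm (toSite rr) Lc (Lc ^ i) (Lc ^ (i + 1))) (reslot Sum.inl Sum.inr fun κ u => cVH • vhSAt (toSite rr) d Lc rfl κ u) κ u
  have h2 := isFF_push₃ (rowMM (KStepUnit (d := d) Lc i) Lc) (respStepBm (toSite rr) Lc (Lc ^ i) (Lc ^ (i + 1)))
    (respStepBm (toSite rr) Lc (Lc ^ i) (Lc ^ (i + 1))) (reslot Sum.inr Sum.inl fun κ u => cVH • vhSAt (toSite rr) d Lc rfl κ u) κ u
  exact isFF_smul (isFF_neg (isFF_add h1 h2)) _

/-- [folklore] The one-step image of the V-source is in the class of local stencil families (leaf-03's `unitS_stepMap` backwards + `isLoc_stepMap` + `locStencil_unitS`). -/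
theorem isLoc_unitStepMap_v {rr : Fin (d + 1) → ℕ} (hrr : rr ∈ box (d + 1) Lc) (cE cVH : ℝ) (i : ℕ) :
    ∃ Cs δ : ℝ, 0 < δ ∧ LocStencil (unitStepMap Lc (toSite rr) cE i (fun κ u => cVH • vhSAt (toSite rr) d Lc rfl κ u)) Cs δ := by
  rw [← unitS_freshAt_v (toSite rr) cVH i, ← unitS_stepMap]
  obtain ⟨C, δ, hδ, h⟩ := isLoc_stepMap hrr cE i (isLoc_freshAt hrr cE cVH 0 i)
  exact ⟨_, δ, hδ, locStencil_unitS h⟩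

/-! ## §3 The V-born remainder in units: the fresh source plus the transported one-step images -/

/-- NOT IN PRINT; OUR BOOKKEEPING ((V8) instance side, V sector; [folklore]).  **THE V-BORN REMAINDER, MEMBER `k`, IN THE ADOPTED UNITS** (in-block root):
`unitS_k (bornSecAt Lc ρ cE cVH 0 k) = cVH • vhSAt ρ + Σ_{i<k} transport unitStepMap (i+1) (k−1−i) X_i`, `X_i := unitStepMap Lc ρ cE i (cVH • vhSAt ρ)` (§2) — the fresh
source (the same table at every level, §1) plus every earlier source pushed ONE dressed step at its birth level and then transported from the next level. -/
theorem unitS_bornV_eq_sum {rr : Fin (d + 1) → ℕ} (hrr : rr ∈ box (d + 1) Lc) (cE cVH : ℝ) (k : ℕ) :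
    unitS (sfStep Lc k) (smStep d Lc k) (bornSecAt Lc (toSite rr) cE cVH 0 k)
      = (fun κ u => cVH • vhSAt (toSite rr) d Lc rfl κ u)
        + ∑ i ∈ Finset.range k, transport (unitStepMap Lc (toSite rr) cE) (i + 1) (k - 1 - i)
            (unitStepMap Lc (toSite rr) cE i (fun κ u => cVH • vhSAt (toSite rr) d Lc rfl κ u)) := by
  rw [unitS_bornSecAt_eq_sum_range hrr cE cVH 0 k, Finset.sum_range_succ, Nat.sub_self, transport_zero, unitS_freshAt_v]
  refine (add_comm _ _).trans ?_
  congr 1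
  refine Finset.sum_congr rfl fun i hi => ?_
  have hik : i < k := Finset.mem_range.1 hi
  rw [unitS_freshAt_v, show k - i = (k - 1 - i) + 1 by omega, transport_succ']

/-- NOT IN PRINT; OUR BOOKKEEPING ((V8) instance side, V sector; [folklore]).  **THE SAME WITH EVERY TRANSPORT OF `≥ 1` STEP WRITTEN AS ONE THREE-LEG PUSH FROM THE
NEXT LEVEL** (leaf-03's `transport_unitStepMap_succ_eq_push₃` at base `i+1`; the one-step image is ff-valued and local, §2): for `k ≥ 1`,
`unitS_k (bornSecAt Lc ρ cE cVH 0 k) = cVH • vhSAt ρ + X_{k−1} + Σ_{i<k−1} (cE·Lc^{2(d+1)})^{k−1−i} • push₃ T′_i T′_i T′_i X_i`, `T′_i = legChain (respStepBmSeq ρ Lc) (i+1) (k−2−i)`. -/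
theorem unitS_bornV_eq_sum_push₃ {rr : Fin (d + 1) → ℕ} (hrr : rr ∈ box (d + 1) Lc) (cE cVH : ℝ) (k : ℕ) :
    unitS (sfStep Lc (k + 1)) (smStep d Lc (k + 1)) (bornSecAt Lc (toSite rr) cE cVH 0 (k + 1))
      = (fun κ u => cVH • vhSAt (toSite rr) d Lc rfl κ u)
        + unitStepMap Lc (toSite rr) cE k (fun κ u => cVH • vhSAt (toSite rr) d Lc rfl κ u)
        + ∑ i ∈ Finset.range k, fun κ' u' => (cE * (Lc : ℝ) ^ (2 * (d + 1))) ^ (k - i) •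
            push₃ (legChain (respStepBmSeq (toSite rr) Lc) (i + 1) (k - 1 - i)) (legChain (respStepBmSeq (toSite rr) Lc) (i + 1) (k - 1 - i))
              (legChain (respStepBmSeq (toSite rr) Lc) (i + 1) (k - 1 - i))
              (unitStepMap Lc (toSite rr) cE i (fun κ u => cVH • vhSAt (toSite rr) d Lc rfl κ u)) κ' u' := by
  rw [unitS_bornV_eq_sum hrr cE cVH (k + 1), Finset.sum_range_succ, show k + 1 - 1 - k = 0 by omega, transport_zero, add_assoc]
  congr 1
  refine (add_comm _ _).trans ?_
  congr 1
  refine Finset.sum_congr rfl fun i hi => ?_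
  have hik : i < k := Finset.mem_range.1 hi
  obtain ⟨n, hn⟩ : ∃ n, k + 1 - 1 - i = n + 1 := ⟨k - 1 - i, by omega⟩
  have hn' : k - i = n + 1 := by omega
  have hn'' : k - 1 - i = n := by omega
  rw [hn, hn', hn'', transport_unitStepMap_succ_eq_push₃ hrr cE (i + 1) (fun κ u => isFF_unitStepMap_v hrr cE cVH i κ u)
    (isLoc_unitStepMap_v hrr cE cVH i) n]

end Summit.QuantumFields.BalabanUV.Beta.GAN24.BornBorderLineage

end
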